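import Summits.PneNP.PneNP.Theorems.ExpanderLinearGeneratorsLinearGeneratorModPFregeHardMod2Prelim
import Mathlib.Data.Nat.Choose.Bounds
import HarnessLib

/-!
# Sparse systems with distinct supports are small: `m ≤ (ℓ+1)(n+1)^ℓ` and
`|ofCNF (sumEncoding 1 E)| ≤ m·2^ℓ·(3ℓ+2) + 1`

Support file for item `stmt-PneNP-11444` (`LinearGeneratorModPFregeHard`), calibration line "for
`p = 2` the rung fails".  To confront the polynomial upper bound `exists_modTwo_refutation`
(`…Mod2Easy.lean`, polynomial in `|ofCNF (sumEncoding 1 E)| + m + n`) with the rung's lower bound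
`2^(n^ε)` one needs the refuted formula to be polynomial in `n` on the rung's instances: an
`ℓ`-sparse system whose rows have pairwise distinct supports (which boundary expansion enforces,
`supp_ne_of_expander`) has at most `(ℓ+1)(n+1)^ℓ` rows (`card_rows_le_of_supp_injective`), and its
sum-encoding has at most `m·2^ℓ` clauses of at most `ℓ` literals (`size_ofCNF_sumEncoding_le`);
together `|ofCNF φ| + m + n + 2 ≤ ((ℓ+1)(2^ℓ(3ℓ+2)+1) + 4)·(n+1)^ℓ` (`param_le_of_sparse`).

No definitions are introduced.

Sources: C. Beck, *Time and Space in Proof Complexity* (2017), Def. 5.6 (`sumEncoding`);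
folklore counting.
-/

set_option linter.dupNamespace false -- `Summit.PneNP.PneNP.…`: summit = sub-problem (D-0017)

namespace Summit.PneNP.PneNP.Theorems.ModTwo

open Literature.Computability.Complexity Literature.Computability.Complexity.PropForm
open Literature.Computability.MetaComplexity
open Literature.Computability.MetaComplexity.KEval (litForm clauseForm clauseForm_cons ofCNF_cons)

/-! ### Few rows -/

/-- **Rows with pairwise distinct supports of size `≤ ℓ` are few**: `m ≤ (ℓ+1)(n+1)^ℓ` (inject
the rows into the subsets of `[n]` of size `≤ ℓ`, of which there are `Σ_{k ≤ ℓ} C(n,k)`).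
[folklore] -/
theorem card_rows_le_of_supp_injective {n m ℓ : ℕ} (E : Fin m → LinEqMod 2 n)
    (hsparse : ∀ i, (E i).supp.card ≤ ℓ) (hinj : Function.Injective fun i => (E i).supp) :
    m ≤ (ℓ + 1) * (n + 1) ^ ℓ := by
  classical
  let B : Finset (Finset (Fin n)) :=
    (Finset.range (ℓ + 1)).biUnion fun k => Finset.powersetCard k Finset.univ
  have hmem : ∀ i ∈ (Finset.univ : Finset (Fin m)), (E i).supp ∈ B := by
    intro i _
    simp only [B, Finset.mem_biUnion, Finset.mem_range, Finset.mem_powersetCard]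
    exact ⟨(E i).supp.card, Nat.lt_succ_of_le (hsparse i), Finset.subset_univ _, rfl⟩
  have h1 : (Finset.univ : Finset (Fin m)).card ≤ B.card :=
    Finset.card_le_card_of_injOn (fun i => (E i).supp) hmem (hinj.injOn)
  have h2 : B.card ≤ (ℓ + 1) * (n + 1) ^ ℓ := by
    calc B.card ≤ ∑ k ∈ Finset.range (ℓ + 1),
          (Finset.powersetCard k (Finset.univ : Finset (Fin n))).card := Finset.card_biUnion_le
      _ = ∑ k ∈ Finset.range (ℓ + 1), n.choose k := by simp [Finset.card_powersetCard]
      _ ≤ ∑ _k ∈ Finset.range (ℓ + 1), (n + 1) ^ ℓ := Finset.sum_le_sum fun k hk => by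
          calc n.choose k ≤ n ^ k := Nat.choose_le_pow n k
            _ ≤ (n + 1) ^ k := Nat.pow_le_pow_left (Nat.le_succ n) k
            _ ≤ (n + 1) ^ ℓ :=
              Nat.pow_le_pow_right (Nat.succ_pos n) (Nat.lt_succ_iff.1 (Finset.mem_range.1 hk))
      _ = (ℓ + 1) * (n + 1) ^ ℓ := by simp
  simpa using h1.trans h2

/-! ### Small encoding -/

/-- A clause formula has size `≤ 3·(number of literals) + 1`. [folklore] -/
theorem size_clauseForm_le (C : Clause ℕ) : (clauseForm C).size ≤ 3 * C.length + 1 := by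
  induction C with
  | nil => simp [clauseForm, size]
  | cons l C ih =>
    rw [clauseForm_cons]
    have := size_litForm_le l
    simp only [size, List.length_cons]
    omega

/-- `|ofCNF φ| ≤ |φ|·(3b+2) + 1` when every clause has at most `b` literals. [folklore] -/
theorem size_ofCNF_le (b : ℕ) :
    ∀ φ : CNF ℕ, (∀ C ∈ φ, C.length ≤ b) → (PropForm.ofCNF φ).size ≤ φ.length * (3 * b + 2) + 1
  | [], _ => by simp [PropForm.ofCNF, size]
  | C :: φ, h => by
    rw [ofCNF_cons]
    have h1 := size_clauseForm_le C
    have h2 := h C List.mem_cons_self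
    have h3 := size_ofCNF_le b φ fun C' hC' => h C' (List.mem_cons_of_mem _ hC')
    simp only [size, List.length_cons]
    nlinarith

/-- A row contributes at most `2^|supp|` canonical clauses. [Beck 2017, Def. 5.6] [folklore] -/
theorem length_equationCNF_one_le {n : ℕ} (e : LinEqMod 2 n) :
    (equationCNF 1 e).length ≤ 2 ^ e.supp.card := by
  rw [equationCNF, canonicalCNF, List.length_map]
  calc _ ≤ (eqVars 1 e).sublists.length := List.length_filter_le _ _
    _ = 2 ^ (eqVars 1 e).length := List.length_sublists _
    _ = 2 ^ e.supp.card := by rw [length_eqVars, mul_one]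

/-- **The sum-encoding of an `ℓ`-sparse system is small**:
`|ofCNF (sumEncoding 1 E)| ≤ m·2^ℓ·(3ℓ+2) + 1`. [Beck 2017, Def. 5.6] [folklore] -/
theorem size_ofCNF_sumEncoding_le {n m ℓ : ℕ} (E : Fin m → LinEqMod 2 n)
    (hsparse : ∀ i, (E i).supp.card ≤ ℓ) :
    (PropForm.ofCNF (sumEncoding 1 E)).size ≤ m * 2 ^ ℓ * (3 * ℓ + 2) + 1 := by
  have hlen : (sumEncoding 1 E).length ≤ m * 2 ^ ℓ := by
    rw [sumEncoding, List.length_flatMap]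
    have h := List.sum_le_card_nsmul ((List.finRange m).map fun k => (equationCNF 1 (E k)).length)
      (2 ^ ℓ) (by
        intro x hx
        obtain ⟨k, -, rfl⟩ := List.mem_map.1 hx
        exact (length_equationCNF_one_le (E k)).trans (Nat.pow_le_pow_right (by norm_num) (hsparse k)))
    simpa [Function.comp_def] using h
  have hwidth : ∀ C ∈ sumEncoding 1 E, C.length ≤ ℓ := by
    intro C hC
    simp only [sumEncoding, List.mem_flatMap, List.mem_finRange, true_and] at hC
    obtain ⟨k, hk⟩ := hC
    rw [length_of_mem_canonicalCNF hk, length_eqVars, mul_one]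
    exact hsparse k
  calc _ ≤ (sumEncoding 1 E).length * (3 * ℓ + 2) + 1 := size_ofCNF_le ℓ _ hwidth
    _ ≤ m * 2 ^ ℓ * (3 * ℓ + 2) + 1 := by
        have := Nat.mul_le_mul_right (3 * ℓ + 2) hlen; omega

/-- **The parameter of the polynomial bound is polynomial in `n` on sparse systems with distinct
supports**: `|ofCNF (sumEncoding 1 E)| + m + n + 2 ≤ ((ℓ+1)·(2^ℓ(3ℓ+2)+1) + 4)·(n+1)^ℓ`
(`ℓ ≥ 1`). [folklore] -/
theorem param_le_of_sparse {n m ℓ : ℕ} (E : Fin m → LinEqMod 2 n) (hℓ : 1 ≤ ℓ)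
    (hsparse : ∀ i, (E i).supp.card ≤ ℓ) (hinj : Function.Injective fun i => (E i).supp) :
    (PropForm.ofCNF (sumEncoding 1 E)).size + m + n + 2 ≤
      ((ℓ + 1) * (2 ^ ℓ * (3 * ℓ + 2) + 1) + 4) * (n + 1) ^ ℓ := by
  have hS := size_ofCNF_sumEncoding_le E hsparse
  have hm := card_rows_le_of_supp_injective E hsparse hinj
  have hpow : n + 1 ≤ (n + 1) ^ ℓ := by
    calc n + 1 = (n + 1) ^ 1 := (pow_one _).symm
      _ ≤ (n + 1) ^ ℓ := Nat.pow_le_pow_right (Nat.succ_pos n) hℓ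
  have h1 : (PropForm.ofCNF (sumEncoding 1 E)).size + m ≤ m * (2 ^ ℓ * (3 * ℓ + 2) + 1) + 1 := by
    nlinarith [hS]
  have h2 : m * (2 ^ ℓ * (3 * ℓ + 2) + 1) ≤ (ℓ + 1) * (n + 1) ^ ℓ * (2 ^ ℓ * (3 * ℓ + 2) + 1) :=
    Nat.mul_le_mul_right _ hm
  nlinarith [h1, h2, hpow]

end Summit.PneNP.PneNP.Theorems.ModTwo
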